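import Mathlib
import Summits.ValiantsHypothesis.ValiantsHypothesis.Theorems.LacunarySymmetroidMatrixDescartesDoorA26WallBubblingExpNewtonBase

/-!
# Exponential Newton inequalities (ENS) for Descartes-saturated real exponential sums — part 2: the robust theorem

Helper for the line `Cruxes/DoorA26/Lines/wall_bubbling.lean` (stmt-ValiantsHypothesis-19979, `Theses.LacunarySymmetroid.DoorA26`),
obligation (M): item (v) of the soundness ledger of the second-order sieve (`Lines/wall_bubbling_M-sieve.md` §2.4 «ENS», §2.6, §5).
THIS MODULE: invariance of the ENS weights `c_y = |classSum y| · ∏_{y' ≠ y} |y − y'|` under twisting (`ensWeight_twist`), the induction on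
the number of active classes (`robust_exp_newton_aux`), the ROBUST ENS THEOREM `robust_exp_newton` (a coefficient/exponent-convergent
family of real exponential sums, frequently Descartes-saturated in a fixed window — e.g. a saturated cluster of `ClusterLimit` — has the
limit points `(y, log c_y)` of every triple of active classes in weak CONCAVE position) and the one-sum corollary `exp_newton` (n − 1
DISTINCT real zeros ⇒ concave position; memo §2.4 «ENS THEOREM», simple-zero case).  Part 1 (`…WallBubblingExpNewtonBase`) holds the tools
and the three-class base.  Multiplicities are never used (Laguerre's twisted Rolle, as in `robust_term_count`).
HONEST FRAMING: elementary real analysis (folklore in spirit; nearest print Descartes–Laguerre for exponential sums, Braess 1986 VI.1.2);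
a helper of the (M) INSTRUMENT only — nothing here bears on `DoorA26` (OPEN; (W), (M), (R) remain), on `MatrixDescartes` (18050) or on
`VP ≠ VNP`.  Seat: prover val-sym-lift-p2 g17 (lead g27 R2664/R2665/R2667), `--supports stmt-ValiantsHypothesis-19979`.
-/

-- `Summit.ValiantsHypothesis.ValiantsHypothesis.…` repeats a component by the D-0017 layout
-- (single-conjunct summit), which the `dupNamespace` linter flags; the name is mandated.
set_option linter.dupNamespace false

namespace Summit.ValiantsHypothesis.ValiantsHypothesis.Theorems.LacunarySymmetroidMatrixDescartes.WallBubbling.Bubbling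

open Finset Filter Topology

variable {ι : Type*} [Fintype ι]

/-- Twisting at `w₀` and differentiating multiplies the class sum of `y` by `y − w₀` and removes the class `w₀`:
the ENS weight `|classSum y| · ∏_{y' ∈ V ∖ y} |y − y'|` is unchanged. [folklore] -/
theorem ensWeight_twist (a₀ x₀ : ι → ℝ) (V : Finset ℝ) {w₀ y : ℝ} (hw₀ : w₀ ∈ V) (hne : y ≠ w₀) :
    |classSum (fun i => a₀ i * (x₀ i - w₀)) (fun i => x₀ i - w₀) (y - w₀)| *
        ∏ s ∈ ((V.erase w₀).image (fun z => z - w₀)).erase (y - w₀), |(y - w₀) - s|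
      = |classSum a₀ x₀ y| * ∏ y' ∈ V.erase y, |y - y'| := by
  classical
  rw [classSum_twist, sub_add_cancel, abs_mul]
  have hinj : Function.Injective (fun z : ℝ => z - w₀) := fun p q h => by simpa using h
  have himg : ((V.erase w₀).image (fun z => z - w₀)).erase (y - w₀)
      = ((V.erase w₀).erase y).image (fun z => z - w₀) :=
    (Finset.image_erase hinj (V.erase w₀) y).symm
  rw [himg, Finset.prod_image (fun p _ q _ h => hinj h)]
  have hprod : ∏ x ∈ (V.erase w₀).erase y, |y - w₀ - (x - w₀)| = ∏ x ∈ (V.erase y).erase w₀, |y - x| := by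
    rw [Finset.erase_right_comm]
    exact Finset.prod_congr rfl fun x _ => by rw [sub_sub_sub_cancel_right]
  rw [hprod, mul_comm |y - w₀| |classSum a₀ x₀ y|, mul_assoc,
    Finset.mul_prod_erase (V.erase y) (fun x => |y - x|) (Finset.mem_erase.mpr ⟨hne.symm, hw₀⟩)]


/-- Induction on the number of active classes (`#V = n + 3`). [folklore] -/
theorem robust_exp_newton_aux (n : ℕ) :
    ∀ (a x : ℕ → ι → ℝ) (a₀ x₀ : ι → ℝ) (V : Finset ℝ),
      (∀ i, Tendsto (fun ν => a ν i) atTop (𝓝 (a₀ i))) →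
      (∀ i, Tendsto (fun ν => x ν i) atTop (𝓝 (x₀ i))) →
      (∀ y, classSum a₀ x₀ y ≠ 0 ↔ y ∈ V) → V.card = n + 3 →
      ∀ R : ℝ, (∃ᶠ ν in atTop, ∃ Z : Finset ℝ,
        (∀ z ∈ Z, z ∈ Set.Icc (-R) R ∧ expSum (a ν) (x ν) z = 0) ∧ V.card ≤ Z.card + 1) →
      ∀ u v w : ℝ, u ∈ V → v ∈ V → w ∈ V → u < v → v < w →
        (w - v) * Real.log (|classSum a₀ x₀ u| * ∏ y ∈ V.erase u, |u - y|) +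
            (v - u) * Real.log (|classSum a₀ x₀ w| * ∏ y ∈ V.erase w, |w - y|) ≤
          (w - u) * Real.log (|classSum a₀ x₀ v| * ∏ y ∈ V.erase v, |v - y|) := by
  classical
  induction n with
  | zero =>
    intro a x a₀ x₀ V ha hx hV hcard R hsat u v w hu hv hw huv hvw
    have huw : u < w := huv.trans hvw
    have hsub : ({u, v, w} : Finset ℝ) ⊆ V := by
      intro y hy
      simp only [Finset.mem_insert, Finset.mem_singleton] at hy
      rcases hy with rfl | rfl | rfl <;> assumption
    have hT : ({u, v, w} : Finset ℝ).card = 3 :=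
      Finset.card_eq_three.mpr ⟨u, v, w, huv.ne, huw.ne, hvw.ne, rfl⟩
    have hVeq : ({u, v, w} : Finset ℝ) = V := Finset.eq_of_subset_of_card_le hsub (by omega)
    subst hVeq
    have eu : ({u, v, w} : Finset ℝ).erase u = {v, w} := by
      rw [Finset.erase_insert]
      simp [huv.ne, huw.ne]
    have ev : ({u, v, w} : Finset ℝ).erase v = {u, w} := by
      rw [Finset.erase_insert_of_ne huv.ne, Finset.erase_insert]
      simp [hvw.ne]
    have ew : ({u, v, w} : Finset ℝ).erase w = {u, v} := by
      rw [Finset.erase_insert_of_ne huw.ne, Finset.erase_insert_of_ne hvw.ne, Finset.erase_singleton]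
      rfl
    rw [eu, ev, ew, Finset.prod_pair hvw.ne, Finset.prod_pair huw.ne, Finset.prod_pair huv.ne,
      abs_of_neg (sub_neg.mpr huv), abs_of_neg (sub_neg.mpr huw), abs_of_pos (sub_pos.mpr huv),
      abs_of_neg (sub_neg.mpr hvw), abs_of_pos (sub_pos.mpr huw), abs_of_pos (sub_pos.mpr hvw),
      neg_sub, neg_sub, neg_sub]
    have hV' : ∀ y, classSum a₀ x₀ y ≠ 0 → y = u ∨ y = v ∨ y = w := by
      intro y hy
      simpa [Finset.mem_insert, Finset.mem_singleton] using (hV y).mp hy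
    have hsat2 : ∃ᶠ ν in atTop, ∃ Z : Finset ℝ,
        (∀ z ∈ Z, z ∈ Set.Icc (-R) R ∧ expSum (a ν) (x ν) z = 0) ∧ 2 ≤ Z.card :=
      hsat.mono fun ν ⟨Z, hZ, hc⟩ => ⟨Z, hZ, by omega⟩
    have key := exp_newton_base a x a₀ x₀ ha hx huv hvw ((hV u).mpr hu) ((hV v).mpr hv) ((hV w).mpr hw)
      hV' R hsat2
    exact key
  | succ n ih =>
    intro a x a₀ x₀ V ha hx hV hcard R hsat u v w hu hv hw huv hvw
    have huw : u < w := huv.trans hvw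
    -- a fourth active class
    obtain ⟨w₀, hw₀V, hw₀T⟩ : ∃ w₀, w₀ ∈ V ∧ w₀ ∉ ({u, v, w} : Finset ℝ) :=
      Finset.exists_mem_notMem_of_card_lt_card (lt_of_le_of_lt Finset.card_le_three (by omega))
    simp only [Finset.mem_insert, Finset.mem_singleton, not_or] at hw₀T
    obtain ⟨hw₀u, hw₀v, hw₀w⟩ := hw₀T
    -- twisted data
    set a' : ℕ → ι → ℝ := fun ν i => a ν i * (x ν i - w₀) with ha'
    set x' : ℕ → ι → ℝ := fun ν i => x ν i - w₀ with hx'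
    set a₀' : ι → ℝ := fun i => a₀ i * (x₀ i - w₀) with ha₀'
    set x₀' : ι → ℝ := fun i => x₀ i - w₀ with hx₀'
    set V' : Finset ℝ := (V.erase w₀).image (fun z => z - w₀) with hV'
    have ha't : ∀ i, Tendsto (fun ν => a' ν i) atTop (𝓝 (a₀' i)) :=
      fun i => (ha i).mul ((hx i).sub_const w₀)
    have hx't : ∀ i, Tendsto (fun ν => x' ν i) atTop (𝓝 (x₀' i)) :=
      fun i => (hx i).sub_const w₀
    have hclass : ∀ s, classSum a₀' x₀' s = s * classSum a₀ x₀ (s + w₀) :=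
      fun s => classSum_twist a₀ x₀ w₀ s
    have hinj : Function.Injective (fun z : ℝ => z - w₀) := fun p q h => by simpa using h
    have hmemV' : ∀ y, y ∈ V → y ≠ w₀ → y - w₀ ∈ V' := fun y hy hne =>
      Finset.mem_image.mpr ⟨y, Finset.mem_erase.mpr ⟨hne, hy⟩, rfl⟩
    have hVcov : ∀ s, classSum a₀' x₀' s ≠ 0 ↔ s ∈ V' := by
      intro s
      rw [hclass]
      constructor
      · intro hs
        have hs0 : s ≠ 0 := fun h => by rw [h, zero_mul] at hs; exact hs rfl
        have hmem : s + w₀ ∈ V := (hV _).mp (right_ne_zero_of_mul hs)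
        have := hmemV' (s + w₀) hmem (fun h => hs0 (by linarith))
        simpa using this
      · intro hs
        obtain ⟨y, hy, rfl⟩ := Finset.mem_image.mp hs
        obtain ⟨hne, hyV⟩ := Finset.mem_erase.mp hy
        rw [sub_add_cancel]
        exact mul_ne_zero (sub_ne_zero.mpr hne) ((hV y).mpr hyV)
    have hcard' : V'.card = n + 3 := by
      rw [hV', Finset.card_image_of_injective _ hinj, Finset.card_erase_of_mem hw₀V, hcard]
      rfl
    have hsat' : ∃ᶠ ν in atTop, ∃ Z : Finset ℝ,
        (∀ z ∈ Z, z ∈ Set.Icc (-R) R ∧ expSum (a' ν) (x' ν) z = 0) ∧ V'.card ≤ Z.card + 1 := by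
      have h0 : ∃ᶠ ν in atTop, ∃ Z : Finset ℝ,
          (∀ z ∈ Z, z ∈ Set.Icc (-R) R ∧ expSum (a ν) (x ν) z = 0) ∧ (n + 2) + 1 ≤ Z.card := by
        refine hsat.mono fun ν hν => ?_
        obtain ⟨Z, hZ, hc⟩ := hν
        refine ⟨Z, hZ, ?_⟩
        rw [hcard] at hc
        omega
      have h1 := frequently_zeros_twist a x w₀ R (n + 2) h0
      refine h1.mono fun ν hν => ?_
      obtain ⟨Z, hZ, hc⟩ := hν
      refine ⟨Z, hZ, ?_⟩
      rw [hcard']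
      omega
    have key := ih a' x' a₀' x₀' V' ha't hx't hVcov hcard' R hsat' (u - w₀) (v - w₀) (w - w₀)
      (hmemV' u hu (Ne.symm hw₀u)) (hmemV' v hv (Ne.symm hw₀v)) (hmemV' w hw (Ne.symm hw₀w))
      (by linarith) (by linarith)
    rw [ensWeight_twist a₀ x₀ V hw₀V (Ne.symm hw₀u), ensWeight_twist a₀ x₀ V hw₀V (Ne.symm hw₀v),
      ensWeight_twist a₀ x₀ V hw₀V (Ne.symm hw₀w)] at key
    simpa only [sub_sub_sub_cancel_right] using key

/-- **ROBUST EXPONENTIAL NEWTON INEQUALITIES (ENS).**  Let `g_ν = expSum (a ν) (x ν)` be a family of real exponential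
sums with coefficientwise and exponentwise limits `a₀, x₀`, let `V` be the set of ACTIVE limit classes
(`classSum a₀ x₀ w ≠ 0 ↔ w ∈ V`), and suppose the family is frequently DESCARTES-SATURATED in a fixed window: for
infinitely many `ν`, `g_ν` has at least `#V − 1` distinct zeros in `[−R, R]`.  Then for every triple `u < v < w` in `V`
the points `(y, log c_y)`, `c_y = |classSum a₀ x₀ y| · ∏_{y' ∈ V, y' ≠ y} |y − y'|`, are in weak CONCAVE position:
`(w − v)·log c_u + (v − u)·log c_w ≤ (w − u)·log c_v`.  (Memo `wall_bubbling_M-sieve.md` §2.4, robust form; a saturated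
cluster of `ClusterLimit` is the intended instance.) [folklore] -/
theorem robust_exp_newton (a x : ℕ → ι → ℝ) (a₀ x₀ : ι → ℝ) (V : Finset ℝ)
    (ha : ∀ i, Tendsto (fun ν => a ν i) atTop (𝓝 (a₀ i)))
    (hx : ∀ i, Tendsto (fun ν => x ν i) atTop (𝓝 (x₀ i)))
    (hV : ∀ w, classSum a₀ x₀ w ≠ 0 ↔ w ∈ V) (R : ℝ)
    (hsat : ∃ᶠ ν in atTop, ∃ Z : Finset ℝ,
      (∀ z ∈ Z, z ∈ Set.Icc (-R) R ∧ expSum (a ν) (x ν) z = 0) ∧ V.card ≤ Z.card + 1)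
    {u v w : ℝ} (hu : u ∈ V) (hv : v ∈ V) (hw : w ∈ V) (huv : u < v) (hvw : v < w) :
    (w - v) * Real.log (|classSum a₀ x₀ u| * ∏ y ∈ V.erase u, |u - y|) +
      (v - u) * Real.log (|classSum a₀ x₀ w| * ∏ y ∈ V.erase w, |w - y|) ≤
    (w - u) * Real.log (|classSum a₀ x₀ v| * ∏ y ∈ V.erase v, |v - y|) := by
  classical
  have hsub : ({u, v, w} : Finset ℝ) ⊆ V := by
    intro y hy
    simp only [Finset.mem_insert, Finset.mem_singleton] at hy
    rcases hy with rfl | rfl | rfl <;> assumption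
  have hT : ({u, v, w} : Finset ℝ).card = 3 :=
    Finset.card_eq_three.mpr ⟨u, v, w, huv.ne, (huv.trans hvw).ne, hvw.ne, rfl⟩
  have h3 : 3 ≤ V.card := hT ▸ Finset.card_le_card hsub
  exact robust_exp_newton_aux (V.card - 3) a x a₀ x₀ V ha hx hV (by omega) R hsat u v w hu hv hw huv hvw

/-- **EXPONENTIAL NEWTON INEQUALITIES (one sum, distinct zeros).**  If a real exponential sum `expSum a₀ x₀` whose set of
active classes is `V` vanishes at `#V − 1` distinct real points, then for every triple `u < v < w` of active classes
`(w − v)·log c_u + (v − u)·log c_w ≤ (w − u)·log c_v`, `c_y = |classSum y| · ∏_{y' ≠ y} |y − y'|` — the points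
`(y, log c_y)` are in concave position («ENS THEOREM» of `wall_bubbling_M-sieve.md` §2.4 for simple zeros; for three terms
`1 − a e^{ht} + b e^{h′t}` with two zeros it is `h′ log a − h log b ≥ −h log (h/h′) − (h′−h) log ((h′−h)/h′)`). [folklore] -/
theorem exp_newton (a₀ x₀ : ι → ℝ) (V : Finset ℝ) (hV : ∀ w, classSum a₀ x₀ w ≠ 0 ↔ w ∈ V)
    (Z : Finset ℝ) (hZ : ∀ z ∈ Z, expSum a₀ x₀ z = 0) (hcard : V.card ≤ Z.card + 1)
    {u v w : ℝ} (hu : u ∈ V) (hv : v ∈ V) (hw : w ∈ V) (huv : u < v) (hvw : v < w) :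
    (w - v) * Real.log (|classSum a₀ x₀ u| * ∏ y ∈ V.erase u, |u - y|) +
      (v - u) * Real.log (|classSum a₀ x₀ w| * ∏ y ∈ V.erase w, |w - y|) ≤
    (w - u) * Real.log (|classSum a₀ x₀ v| * ∏ y ∈ V.erase v, |v - y|) := by
  set R : ℝ := ∑ z ∈ Z, |z| with hR
  have hwin : ∀ z ∈ Z, z ∈ Set.Icc (-R) R := by
    intro z hz
    have : |z| ≤ R := Finset.single_le_sum (f := fun z => |z|) (fun _ _ => abs_nonneg _) hz
    exact ⟨by linarith [neg_abs_le z], le_trans (le_abs_self z) this⟩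
  refine robust_exp_newton (fun _ => a₀) (fun _ => x₀) a₀ x₀ V (fun _ => tendsto_const_nhds)
    (fun _ => tendsto_const_nhds) hV R (Filter.Frequently.of_forall fun _ => ?_) hu hv hw huv hvw
  exact ⟨Z, fun z hz => ⟨hwin z hz, hZ z hz⟩, hcard⟩

/-- For an INJECTIVE exponent vector every class is a singleton: `classSum a v (v m₀) = a m₀`. [folklore] -/
theorem classSum_of_injective {n : ℕ} (v a : Fin n → ℝ) (hv : Function.Injective v) (m₀ : Fin n) :
    classSum a v (v m₀) = a m₀ := by
  unfold classSum
  rw [Finset.sum_eq_single m₀ (fun m _ hm => if_neg fun h => hm (hv h)) (fun h => absurd (Finset.mem_univ _) h),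
    if_pos rfl]

/-- … and a value outside the range carries the class sum `0`. [folklore] -/
theorem classSum_eq_zero_of_forall_ne {n : ℕ} (v a : Fin n → ℝ) (w : ℝ) (hw : ∀ m, v m ≠ w) :
    classSum a v w = 0 := by
  unfold classSum
  exact Finset.sum_eq_zero fun m _ => if_neg (hw m)

/-- **ENS in the line lead's typed shape** (`Cruxes/DoorA26/Lines/wall_bubbling_ENS.lean`, `Stmt.ens`, with its `expSum`
and `weight` unfolded — the chain's `expSum a v` is the same sum): for strictly increasing exponents `v : Fin n → ℝ`,
nonzero coefficients `a`, and `n − 1` distinct real zeros, every index triple `i < j < k` satisfies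
`(v k − v j)·c i + (v j − v i)·c k ≤ (v k − v i)·c j`, `c m = log (|a m| · ∏_{k ≠ m} |v m − v k|)`. [folklore] -/
theorem ens_distinct (n : ℕ) (v a : Fin n → ℝ) (hv : StrictMono v) (ha : ∀ m, a m ≠ 0)
    (hz : ∃ z : Fin (n - 1) → ℝ, Function.Injective z ∧ ∀ i, expSum a v (z i) = 0)
    (i j k : Fin n) (hij : i < j) (hjk : j < k) :
    (v k - v j) * Real.log (|a i| * ∏ k' ∈ Finset.univ.erase i, |v i - v k'|) +
      (v j - v i) * Real.log (|a k| * ∏ k' ∈ Finset.univ.erase k, |v k - v k'|) ≤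
    (v k - v i) * Real.log (|a j| * ∏ k' ∈ Finset.univ.erase j, |v j - v k'|) := by
  classical
  obtain ⟨z, hzinj, hz0⟩ := hz
  have hinj : Function.Injective v := hv.injective
  set V : Finset ℝ := Finset.univ.image v with hVdef
  have hV : ∀ w, classSum a v w ≠ 0 ↔ w ∈ V := by
    intro w
    constructor
    · intro hw
      by_contra hmem
      apply hw
      refine classSum_eq_zero_of_forall_ne v a w fun m h => hmem ?_
      exact Finset.mem_image.mpr ⟨m, Finset.mem_univ _, h⟩
    · intro hw
      obtain ⟨m, _, rfl⟩ := Finset.mem_image.mp hw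
      rw [classSum_of_injective v a hinj]
      exact ha m
  have hcard : V.card ≤ (Finset.univ.image z).card + 1 := by
    rw [hVdef, Finset.card_image_of_injective _ hinj, Finset.card_image_of_injective _ hzinj,
      Finset.card_univ, Finset.card_univ, Fintype.card_fin, Fintype.card_fin]
    omega
  have hmem : ∀ m, v m ∈ V := fun m => Finset.mem_image.mpr ⟨m, Finset.mem_univ _, rfl⟩
  have key := exp_newton a v V hV (Finset.univ.image z)
    (fun w hw => by obtain ⟨l, _, rfl⟩ := Finset.mem_image.mp hw; exact hz0 l) hcard
    (hmem i) (hmem j) (hmem k) (hv hij) (hv hjk)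
  have hprod : ∀ m₀ : Fin n, ∏ y ∈ V.erase (v m₀), |v m₀ - y| = ∏ k' ∈ Finset.univ.erase m₀, |v m₀ - v k'| := by
    intro m₀
    rw [hVdef, ← Finset.image_erase hinj, Finset.prod_image (fun p _ q _ h => hinj h)]
  rw [classSum_of_injective v a hinj, classSum_of_injective v a hinj, classSum_of_injective v a hinj,
    hprod, hprod, hprod] at key
  exact key

end Summit.ValiantsHypothesis.ValiantsHypothesis.Theorems.LacunarySymmetroidMatrixDescartes.WallBubbling.Bubbling
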